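import Literature.MathematicalPhysics.QuantumFieldTheory.ConformalBootstrap3D.PointKernelK34v2Data
import Literature.MathematicalPhysics.QuantumFieldTheory.ConformalBootstrap3D.PointKernelParts

/-!
# K34v2 certificate, kernel part file P71: one-cell head segments 181, 182, 185 in level ranges

The head cells whose kernel evaluation exceeds one `decide` are one-cell segments of `hsegsK34v2`; each is
checked by `PCert.hPartSideOK` (side conditions) and `PCert.hPartOK` per level range `[n_lo, n_lo + count)`
against an integer claim, the claims summing to `≥ 0` (`PointKernel.partsOK`); soundness is
`PCert.hParts_sound` (`PointKernelParts`).  The part files `P1, P2, …` are mutually independent (each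
imports only the data file); the ranges of one cell may span several of them, and the per-cell
conclusions `hparts_i` / `hcell_i` of those cells are assembled in `PointKernelK34v2.lean`.
Estimated kernel time 208 s.
-/

set_option maxRecDepth 100000
set_option maxHeartbeats 0

namespace Literature.MathematicalPhysics.QuantumFieldTheory.ConformalBootstrap3D.PointKernelK34v2

open Literature.MathematicalPhysics.QuantumFieldTheory.ConformalBootstrap3D.PointKernel

/-- levels `[32, 41)` of segment 181: partial lower sum `≥` claim. [folklore] -/
theorem part_181_1 : certK34v2.hPartOK (PCert.segAt hsegsK34v2 181) JHK34v2 32 9 (10866729570342870551387319443506232836) = true := by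
  decide +kernel

/-- one-cell segment 182 (row 6, cell `[227/32, 909/128]`, chord, `n_F = 40`,
2 level ranges): side conditions. [folklore] -/
theorem pside_182 : certK34v2.hPartSideOK (PCert.segAt hsegsK34v2 182) JHK34v2 = true := by
  decide +kernel

/-- its level ranges `(n_lo, count, claim)`. [folklore] -/
def parts_182 : List (ℕ × ℕ × ℤ) := [(0, 32, -9838890800827985699694850047025786421), (32, 9, 9838890800827985699694850047025786421)]

/-- the ranges tile `[0, n_F]` and the claims sum to `≥ 0`. [folklore] -/
theorem pcov_182 : PointKernel.partsOK 40 parts_182 = true := by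
  decide +kernel

/-- levels `[0, 32)` of segment 182: partial lower sum `≥` claim. [folklore] -/
theorem part_182_0 : certK34v2.hPartOK (PCert.segAt hsegsK34v2 182) JHK34v2 0 32 (-9838890800827985699694850047025786421) = true := by
  decide +kernel

/-- levels `[32, 41)` of segment 182: partial lower sum `≥` claim. [folklore] -/
theorem part_182_1 : certK34v2.hPartOK (PCert.segAt hsegsK34v2 182) JHK34v2 32 9 (9838890800827985699694850047025786421) = true := by
  decide +kernel

/-- one-cell segment 185 (row 6, cell `[455/64, 57/8]`, chord, `n_F = 48`,
3 level ranges): side conditions. [folklore] -/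
theorem pside_185 : certK34v2.hPartSideOK (PCert.segAt hsegsK34v2 185) JHK34v2 = true := by
  decide +kernel

/-- its level ranges `(n_lo, count, claim)`. [folklore] -/
def parts_185 : List (ℕ × ℕ × ℤ) := [(0, 31, -14245489763829514090212464368934197698), (31, 13, 13181285804154641026587294522285656479), (44, 5, 1064203959674873063625169846648541220)]

/-- the ranges tile `[0, n_F]` and the claims sum to `≥ 0`. [folklore] -/
theorem pcov_185 : PointKernel.partsOK 48 parts_185 = true := by
  decide +kernel

/-- levels `[0, 31)` of segment 185: partial lower sum `≥` claim. [folklore] -/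
theorem part_185_0 : certK34v2.hPartOK (PCert.segAt hsegsK34v2 185) JHK34v2 0 31 (-14245489763829514090212464368934197698) = true := by
  decide +kernel

end Literature.MathematicalPhysics.QuantumFieldTheory.ConformalBootstrap3D.PointKernelK34v2
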